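import Literature.IUT.HodgeArakelov.LabelClassesOfCuspsCor24iProofs
import Literature.IUT.HodgeArakelov.LabelClassesOfCuspsCor24iiiProofs

/-!
# [IUTchII] Cor 2.4 (ii) (a) "`D^δ_t ⊆ Π^δ_{v□̈}`": the sub-DAG of the residual clause; the `Π_{v□}`-half PROVED from Cor 2.4 (i)

S. Mochizuki, *Inter-universal Teichmüller theory II*, kurims manuscript (Dec. 2020), §2, Corollary 2.4 (ii),
p. 70 l. 23–74 ([IUTchII] Cor 2.4 (ii), kurims p.70) [claim: Mochizuki2012, status: disputed] (D-0012 claim key;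
series status DISPUTED — elementary group theory over the landed typings only; nothing of the series is asserted).
PROOF-ONLY companion (abc-iut cell, D-0068 (1) sub-DAG `plan/L6/SUBDAG-IUTchII-Cor-24.md`, row W6-S5 of
abc-iut-L6-lead's SUBDAG-WANTED (L6) v1; seat abc-iut-w5-d184; cone node `IUTchII:Cor2.4(ii)`) of
`LabelClassesOfCusps.lean` (abc-iut-L6-t1, p407174), `LabelClassesOfCuspsR.lean` (abc-iut-L6-d1, p408486:
`PlusMinusTower.cuspDecomp`, `Cor24_ii_iii'`), `LabelClassesOfCuspsCor24iProofs.lean` (abc-iut-w4-d012, p411807) and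
`LabelClassesOfCuspsCor24iiiProofs.lean` (abc-iut-w4-d012, p412094).  No definitions; landed modules are not edited.

PRINT (p. 70): "(ii) (Two-torsion Translates of Cusps) In the situation of (i), if we write `δ := γ·γ' ∈ Δ̂^±_v`,
then any inclusion `I^δ_t = I^{γ·γ'}_t ⊆ Π^γ_{v□} = Π^δ_{v□}` as in (i) completely determines the following data:
(a) a decomposition group `D^δ_t := N_{Π^δ_v}(I^δ_t) ⊆ Π^δ_{v□̈}` corresponding to the inertia group `I^δ_t`; (b) …;
(c) …" with (p. 69) "`Π_{v□̈} := Π_{v□} ∩ Π^tp_{Ÿ̲_v}`".  Printed proof (p. 71): "Assertions (ii) and (iii) follow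
immediately from the definitions and the references quoted in the statements of these assertions."

STATE OF THE NODE (folded from the tree).  `cor24_ii_iii'_iff_one` (p412094) shows that the repaired predicate
`Cor24_ii_iii' W C H` — the typed statement of record of Cor. 2.4 (ii)(iii) (R-file p408486; R2 p408509 repairs
Def. 2.3 (ii) / Rmk. 2.4.1; negative `not_Cor24_ii_iii_of_Cor24_indices`, p407862, concerns the PRE-repair `Cor24_ii_iii`)
— is EQUIVALENT to clause (a) at `δ = 1`: "`D_t = N_{Π_v}(I_t) ⊆ Π_{v□̈}` for every cuspidal inertia group
`I_t ⊆ Δ_{v□}`"; the compatibilities of (ii)/(iii) are PROVED there (`cuspDecomp_mul`, `dt_mul`, `dt_indep`).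
This file splits that residual along the two intersectands of `Π_{v□̈} = Π_{v□} ∩ Π^tp_{Ÿ̲_v}` — sub-nodes
**(a.1)** "`D_t ⊆ Π_{v□}`" and **(a.2)** "`D_t ⊆ Π^tp_{Ÿ̲_v}`" of `SUBDAG-IUTchII-Cor-24.md`, stated INLINE as
hypotheses / conjuncts (no new `Prop` is declared, D-0067) — and proves, for ALL tower data:

* `PlusMinusTower.boxDd_eq_box_inf` — `Π_{v□̈} = Π_{v□} ∩ Π^tp_{Ÿ̲_v}` as typed (`boxDd H` is the image of
  `H ⊓ Π^tp_{Ÿ̲_v}` under the injective embedding `Π_v ↪ Π̂^cor_v`);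
* **`cuspDecomp_one_le_box_of_cor24_i`** — **(a.1) PROVED MODULO** the node `IUTchII:Cor2.4(i)` (the typed
  `Cor24_i W C H I` for the cuspidal inertia groups `I ⊆ Δ_{v□}`, of which only "(b) ⟹ (a) at `γ = 1`" is used) and
  two printed inputs stated inline: (S) "`Π^±_{v□} ↠ G_v` relative to `Π_v`" — every element `n ∈ Π_v` has the image
  in `G_v` of some element `m ∈ Π^±_{v□} = N_{Π^±_v}(Π_{v□})`, i.e. `m⁻¹n ∈ Δ̂^cor_v = Ker(Π̂^cor_v ↠ G_v)` ([IUTchI] Cor. 2.3 (iii): `1 → Δ^tp_{X_v,ℍ} → Π^tp_{X_v,ℍ} → G_v → 1`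
  for the `G_v`-stable subgraphs `ℍ ∈ {Γ^{•t}_X, Γ^▶_X}`, Rmk. 2.1.1 (ii) / Def. 2.3 (iv); abc-iut-L5-t1's `Cor23iii`)
  and (E) "`Π^±_{v□} ∩ Π_v = Π_{v□}`" (Def. 2.3 (i) p. 67 "equalities `Π^±_{v•} ∩ Π_v = Π_{v•}`, `Π^±_{v▶} ∩ Π_v = Π_{v▶}`
  [cf. [IUTchI], Corollary 2.3, (iv)]", Def. 2.3 (iv) for `•t`; first conjunct of the typed `Def23_i_indices`).
  ARGUMENT: for `n ∈ N_{Π_v}(I_t)` pick `m ∈ Π^±_{v□}` with the same image in `G_v`; then `d := m⁻¹n ∈ Δ̂^±_v` and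
  `I^d_t = m⁻¹ (n I_t n⁻¹) m = m⁻¹ I_t m ⊆ Π_{v□}` (as `m` normalises `Π_{v□} ⊇ I_t`), so by Cor. 2.4 (i) [(b) ⟹ (a)]
  `d ∈ Δ^±_{v□} ⊆ Π^±_{v□}`, whence `n = m d ∈ Π^±_{v□} ∩ Π_v ⊆ Π_{v□}`;
* `cor24_ii_iii'_iff_box_and_ydd` — EXACTNESS of the sub-DAG: `Cor24_ii_iii' W C H ↔ (a.1) ∧ (a.2)`;
* **`cor24_ii_iii'_of_inputs`** — ASSEMBLY: Cor. 2.4 (i) (for the cuspidal inertia groups in `Δ_{v□}`) + (S) + (E) +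
  (a.2) ⟹ `Cor24_ii_iii' W C H`; `PlusMinusTower.pmBox_inf_piV_le_box_of_def23_i_indices` — (E) for `□ ∈ {•, ▶}` IS
  the first conjunct of the typed `Def23_i_indices Dec W` (node `IUTchII:Def2.3(i)`, by name);
  `cor24_ii_iii'_of_inputs_of_def23_i_indices` — the assembly for `H ∈ {Π_{v•}, Π_{v▶}}` with (E) so supplied.

What is NOT proved here: (a.2) "`D_t ⊆ Π^tp_{Ÿ̲_v}`" (geometric input: the cusps of `X̲_v` split completely in
`Ÿ̲_v` — `Π_{v▶} ⊆ Π^tp_{Y̲_v}` [Prop. 2.2, typed `SubgraphDecomposition.tri_le_YL`] plus the `Gal(Ÿ̲_v/Y̲_v) = {±1}`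
level, Rmk. 2.1.1 (i) / [IUTchI] Ex. 3.2 (ii)); (S) and (E) (L5↔L6 merge obligations, cf. the B13 bridge
`PlusMinusTowerStableCurveBridge`); and Cor. 2.4 (i) itself (node `IUTchII:Cor2.4(i)`, `cor24_i_of_inputs` /
`cor24_i'_of_inputs`).  Nothing here takes a side on [IUTchIII] Cor. 3.12; typed ≠ discharged.
-/

namespace Literature.IUT.HodgeArakelov

universe u

variable {S : BadPlaceSetting.{u}} {P : TopGroup.{u}} {T : TemperedCoverings S P}

/-! ### Plain group theory -/

section Conj

variable {G : Type u} [Group G]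

/-- Conjugation by `1` is the identity on subgroups. [folklore] -/
private theorem map_conj_one' (K : Subgroup G) : K.map (MulAut.conj (1 : G)).toMonoidHom = K := by
  ext y
  rw [Subgroup.mem_map_equiv, MulAut.conj_symm_apply, inv_one, one_mul, mul_one]

end Conj

namespace PlusMinusTower

variable (W : PlusMinusTower T) (H : Subgroup P)

/-- The embedding `Π_v ↪ Π̂^cor_v` (`W.emb ∘ T.incl`) is injective (Def. 2.3 (i) p. 67: `emb` is injective, `incl` is
an open embedding). ([IUTchII] Def 2.3 (i) p.67) [claim: Mochizuki2012, status: disputed] -/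
theorem emb_comp_incl_injective : Function.Injective (W.emb.comp T.incl) :=
  fun _ _ h => T.incl_isOpenEmbedding.injective (W.emb_injective h)

/-- **IUTchII:Cor2.4** preamble (kurims p. 69) "`Π_{v□̈} := Π_{v□} ∩ Π^tp_{Ÿ̲_v}`": the typed `boxDd H` (image of
`H ⊓ Π^tp_{Ÿ̲_v}`) IS the intersection of `Π_{v□}` with the image of `Π^tp_{Ÿ̲_v}` inside `Π̂^cor_v`.  PROVED
(injectivity of `Π_v ↪ Π̂^cor_v`). ([IUTchII] Cor 2.4 p.69) [claim: Mochizuki2012, status: disputed] -/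
theorem boxDd_eq_box_inf :
    W.boxDd H = W.box H ⊓ (T.YddL).map (W.emb.comp T.incl) :=
  Subgroup.map_inf H T.YddL (W.emb.comp T.incl) W.emb_comp_incl_injective

end PlusMinusTower

/-! ### Sub-node (a.1) "`D_t ⊆ Π_{v□}`" from Cor. 2.4 (i) -/

section Cor24ii

variable {W : PlusMinusTower T} {C : CuspidalInertiaData W} {H : Subgroup P}

/-- **IUTchII:Cor2.4(ii)** (a), sub-node **(a.1)** "`D_t ⊆ Π_{v□}`" (kurims p. 70 l. 34–42, first intersectand of
`Π_{v□̈} = Π_{v□} ∩ Π^tp_{Ÿ̲_v}`) **PROVED MODULO** Cor. 2.4 (i) and two printed inputs: if the typed Cor. 2.4 (i)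
`Cor24_i W C H I` holds for the cuspidal inertia groups `I ⊆ Δ_{v□}` (node `IUTchII:Cor2.4(i)`; only "(b) ⟹ (a) at
`γ = 1`" is used), (S) every element `n` of `Π_v` has the same image in `G_v` as some element `m` of
`Π^±_{v□} = N_{Π^±_v}(Π_{v□})`, stated as `m⁻¹n ∈ Ker(Π̂^cor_v ↠ G_v)` ([IUTchI] Cor. 2.3 (iii) for the `G_v`-stable
subgraph `Γ^□`), and (E)
`Π^±_{v□} ∩ Π_v ⊆ Π_{v□}` (Def. 2.3 (i)/(iv) "`Π^±_{v•} ∩ Π_v = Π_{v•}`, `Π^±_{v▶} ∩ Π_v = Π_{v▶}`", kurims p. 67), then the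
decomposition group `D_t = N_{Π_v}(I_t)` (`cuspDecomp I 1`) lies in `Π_{v□}` for every such `I_t`.
PROOF: for `n ∈ N_{Π_v}(I_t)` choose `m ∈ Π^±_{v□}` with the same image in `G_v`; `d := m⁻¹ n` lies in `Δ̂^±_v`, and
`I^d_t = m⁻¹ (n I_t n⁻¹) m = m⁻¹ I_t m ⊆ Π_{v□}` since `m` normalises `Π_{v□} ⊇ I_t`; Cor. 2.4 (i) gives
`d ∈ Δ^±_{v□} ⊆ Π^±_{v□}`, so `n = m d ∈ Π^±_{v□} ∩ Π_v ⊆ Π_{v□}`.  PROVED (group theory).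
([IUTchII] Cor 2.4 (ii) p.70) [claim: Mochizuki2012, status: disputed] -/
theorem cuspDecomp_one_le_box_of_cor24_i
    (h24i : ∀ I : Subgroup W.Corhat, C.IsCuspidalInertia W.piV I → I ≤ W.deltaBox H →
      Literature.IUT.HodgeArakelov.Cor24_i W C H I)
    (hsurj : ∀ n : W.Corhat, n ∈ W.piV → ∃ m : W.Corhat, m ∈ W.pmBox H ∧ m⁻¹ * n ∈ W.aug.ker)
    (hcap : W.pmBox H ⊓ W.piV ≤ W.box H)
    {I : Subgroup W.Corhat} (hI : C.IsCuspidalInertia W.piV I) (hIΔ : I ≤ W.deltaBox H) :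
    W.cuspDecomp I 1 ≤ W.box H := by
  intro n hn
  -- unpack `n ∈ N_{Π_v}(I)` (relative normaliser, conjugation by `1`)
  rw [W.mem_cuspDecomp_iff I 1 n, map_conj_one', map_conj_one'] at hn
  obtain ⟨hnV, hnN⟩ := hn
  have hIbox : I ≤ W.box H := hIΔ.trans (W.deltaBox_le_box H)
  -- Cor. 2.4 (i), read as "(c) ⟹ (a) at `γ = 1`"
  have key := (cor24_i_iff_c_imp_a W C H I).mp (h24i I hI hIΔ) hI hIΔ
  -- `m ∈ Π^±_{v□}` with the same image in `G_v`
  obtain ⟨m, hm, hdker⟩ := hsurj n hnV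
  have hmPM : m ∈ W.piPM := W.pmNormalizer_le_piPM H hm
  set d : W.Corhat := m⁻¹ * n with hd
  have hdHat : d ∈ W.pmHat ⊓ W.aug.ker :=
    Subgroup.mem_inf.mpr
      ⟨W.pmHat.mul_mem (W.pmHat.inv_mem (W.piPM_le_pmHat hmPM))
          (W.piPM_le_pmHat (W.piV_le_piPM hnV)), hdker⟩
  -- `I^d ⊆ Π_{v□} ⊆ Π^±_{v□}`
  have hId : I.map (MulAut.conj d).toMonoidHom ≤ W.pmBox H := by
    intro y hy
    obtain ⟨x, hx, rfl⟩ := Subgroup.mem_map.mp hy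
    have hxV : x ∈ W.piV := W.box_le_piV H (hIbox hx)
    -- `n x n⁻¹ ∈ I ⊆ Π_{v□}`
    have hnx : n * x * n⁻¹ ∈ W.box H := hIbox ((hnN x hxV).mp hx)
    -- `m⁻¹ (n x n⁻¹) m ∈ Π_{v□}` since `m ∈ N_{Π^±_v}(Π_{v□})`
    have hmN := ((W.mem_pmNormalizer_iff H).mp hm).2
    have hconj : m⁻¹ * (n * x * n⁻¹) * m ∈ W.box H := by
      refine (hmN (m⁻¹ * (n * x * n⁻¹) * m)).mpr ?_
      have : m * (m⁻¹ * (n * x * n⁻¹) * m) * m⁻¹ = n * x * n⁻¹ := by group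
      rwa [this]
    have heq : (MulAut.conj d).toMonoidHom x = m⁻¹ * (n * x * n⁻¹) * m := by
      rw [MulEquiv.coe_toMonoidHom, MulAut.conj_apply, hd]; group
    rw [heq]
    exact W.box_le_pmNormalizer H hconj
  -- Cor. 2.4 (i): `d ∈ Δ^±_{v□} ⊆ Π^±_{v□}`; hence `n = m d ∈ Π^±_{v□} ∩ Π_v ⊆ Π_{v□}`
  have hdBox : d ∈ W.pmBox H := key d hdHat hId
  have hnBox : n ∈ W.pmBox H := by
    have : n = m * d := by rw [hd]; group
    rw [this]
    exact (W.pmBox H).mul_mem hm hdBox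
  exact hcap (Subgroup.mem_inf.mpr ⟨hnBox, hnV⟩)

/-! ### Exactness and assembly of the sub-DAG of clause (a) -/

variable (W C H)

/-- **IUTchII:Cor2.4(ii)(iii)′ — EXACTNESS of the sub-DAG** (kurims p. 70): the typed statement of record
`Cor24_ii_iii' W C H` (abc-iut-L6-d1) holds iff both sub-nodes hold — (a.1) "`D_t = N_{Π_v}(I_t) ⊆ Π_{v□}`" and
(a.2) "`D_t ⊆ Π^tp_{Ÿ̲_v}`" (the image of `TemperedCoverings.YddL` in `Π̂^cor_v`; Prop. 2.1 (c)(d)) for every cuspidal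
inertia group `I_t ⊆ Δ_{v□}` (by `cor24_ii_iii'_iff_one` and `Π_{v□̈} = Π_{v□} ∩ Π^tp_{Ÿ̲_v}`).  PROVED.
([IUTchII] Cor 2.4 (ii) p.70) [claim: Mochizuki2012, status: disputed] -/
theorem cor24_ii_iii'_iff_box_and_ydd :
    Literature.IUT.HodgeArakelov.Cor24_ii_iii' W C H ↔
      (∀ I : Subgroup W.Corhat, C.IsCuspidalInertia W.piV I → I ≤ W.deltaBox H →
          W.cuspDecomp I 1 ≤ W.box H) ∧
        ∀ I : Subgroup W.Corhat, C.IsCuspidalInertia W.piV I → I ≤ W.deltaBox H →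
          W.cuspDecomp I 1 ≤ (T.YddL).map (W.emb.comp T.incl) := by
  rw [cor24_ii_iii'_iff_one, W.boxDd_eq_box_inf H]
  constructor
  · intro h
    exact ⟨fun I hI hIΔ => (h I hI hIΔ).trans inf_le_left, fun I hI hIΔ => (h I hI hIΔ).trans inf_le_right⟩
  · rintro ⟨h1, h2⟩ I hI hIΔ
    exact le_inf (h1 I hI hIΔ) (h2 I hI hIΔ)

variable {W C H}

/-- **IUTchII:Cor2.4(ii)(iii)′ — ASSEMBLY of the sub-DAG** (kurims p. 70): the typed statement of record
`Cor24_ii_iii' W C H` follows from (1) Cor. 2.4 (i) for the cuspidal inertia groups in `Δ_{v□}` (node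
`IUTchII:Cor2.4(i)`, typed `Cor24_i`), (2) (S) "`Π^±_{v□} ↠ G_v` relative to `Π_v`" ([IUTchI] Cor. 2.3 (iii)), (3) (E)
`Π^±_{v□} ∩ Π_v ⊆ Π_{v□}` (Def. 2.3 (i)/(iv)), and (4) the sub-node (a.2) "`D_t ⊆ Π^tp_{Ÿ̲_v}`" for the cuspidal inertia
groups in `Δ_{v□}` ("the cusps of `X̲_v` split completely in `Ÿ̲_v`", Rmk. 2.1.1 (i) / [IUTchI] Ex. 3.2 (ii)).  PROVED
(modulo the named inputs, which are hypotheses). ([IUTchII] Cor 2.4 (ii) p.70) [claim: Mochizuki2012, status: disputed] -/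
theorem cor24_ii_iii'_of_inputs
    (h24i : ∀ I : Subgroup W.Corhat, C.IsCuspidalInertia W.piV I → I ≤ W.deltaBox H →
      Literature.IUT.HodgeArakelov.Cor24_i W C H I)
    (hsurj : ∀ n : W.Corhat, n ∈ W.piV → ∃ m : W.Corhat, m ∈ W.pmBox H ∧ m⁻¹ * n ∈ W.aug.ker)
    (hcap : W.pmBox H ⊓ W.piV ≤ W.box H)
    (hYdd : ∀ I : Subgroup W.Corhat, C.IsCuspidalInertia W.piV I → I ≤ W.deltaBox H →
      W.cuspDecomp I 1 ≤ (T.YddL).map (W.emb.comp T.incl)) :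
    Literature.IUT.HodgeArakelov.Cor24_ii_iii' W C H :=
  (cor24_ii_iii'_iff_box_and_ydd W C H).mpr
    ⟨fun _ hI hIΔ => cuspDecomp_one_le_box_of_cor24_i h24i hsurj hcap hI hIΔ, hYdd⟩

/-! ### Input (E) from the typed Def. 2.3 (i) for `□ ∈ {•, ▶}` -/

/-- **IUTchII:Def2.3(i)** (kurims p. 67 l. 112 ff) "equalities `Π^±_{v•} ∩ Π_v = Π_{v•}`, `Π^±_{v▶} ∩ Π_v = Π_{v▶}`
[cf. [IUTchI], Corollary 2.3, (iv)]": input (E) `Π^±_{v□} ∩ Π_v ⊆ Π_{v□}` of the sub-DAG, for `Π_{v□} ∈ {Π_{v•}, Π_{v▶}}`,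
IS the first conjunct of abc-iut-L6-t1's typed predicate `Def23_i_indices Dec W` (node `IUTchII:Def2.3(i)`, taken BY
NAME as a hypothesis).  PROVED (instantiation). ([IUTchII] Def 2.3 (i) p.67) [claim: Mochizuki2012, status: disputed] -/
theorem PlusMinusTower.pmBox_inf_piV_le_box_of_def23_i_indices {D : EtaleThetaData S.toThetaSetting P}
    (Dec : SubgraphDecomposition S T D) (hDef : Def23_i_indices Dec W) (hH : H = Dec.Pbullet ∨ H = Dec.Ptri) :
    W.pmBox H ⊓ W.piV ≤ W.box H := by
  have hmem : H ∈ ({Dec.Pbullet, Dec.Ptri} : Set (Subgroup P)) := by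
    rcases hH with rfl | rfl
    · exact Set.mem_insert _ _
    · exact Set.mem_insert_of_mem _ rfl
  exact (hDef H hmem).1.le

/-- **IUTchII:Cor2.4(ii)(iii)′ for `□ = ▶` (and `□ = •`)** (kurims p. 70): with input (E) supplied BY NAME by the
typed Def. 2.3 (i) predicate `Def23_i_indices Dec W`, the statement of record `Cor24_ii_iii' W C H` for
`H ∈ {Π_{v•}, Π_{v▶}}` follows from Cor. 2.4 (i) (for the cuspidal inertia groups in `Δ_{v□}`), input (S)
([IUTchI] Cor. 2.3 (iii)) and sub-node (a.2) "`D_t ⊆ Π^tp_{Ÿ̲_v}`".  PROVED (modulo the named inputs).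
([IUTchII] Cor 2.4 (ii) p.70) [claim: Mochizuki2012, status: disputed] -/
theorem cor24_ii_iii'_of_inputs_of_def23_i_indices {D : EtaleThetaData S.toThetaSetting P}
    (Dec : SubgraphDecomposition S T D) (hDef : Def23_i_indices Dec W) (hH : H = Dec.Pbullet ∨ H = Dec.Ptri)
    (h24i : ∀ I : Subgroup W.Corhat, C.IsCuspidalInertia W.piV I → I ≤ W.deltaBox H →
      Literature.IUT.HodgeArakelov.Cor24_i W C H I)
    (hsurj : ∀ n : W.Corhat, n ∈ W.piV → ∃ m : W.Corhat, m ∈ W.pmBox H ∧ m⁻¹ * n ∈ W.aug.ker)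
    (hYdd : ∀ I : Subgroup W.Corhat, C.IsCuspidalInertia W.piV I → I ≤ W.deltaBox H →
      W.cuspDecomp I 1 ≤ (T.YddL).map (W.emb.comp T.incl)) :
    Literature.IUT.HodgeArakelov.Cor24_ii_iii' W C H :=
  cor24_ii_iii'_of_inputs h24i hsurj (W.pmBox_inf_piV_le_box_of_def23_i_indices Dec hDef hH) hYdd

end Cor24ii

end Literature.IUT.HodgeArakelov
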